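import Literature.NumberTheory.LFunctions.GcdSumBounds
import HarnessLib

/-!
# The gcd sum of the Type II numerology (Polymath 8a, §5.4, (5.33)–(5.34))

Topic `Literature/NumberTheory/Sieve`, grouping namespace `Polymath8a`; a support file for the named
fact `Literature.NumberTheory.Sieve.mpz_of_lt` (**parity.S29**).  Source: D. H. J. Polymath,
*New equidistribution estimates of Zhang type*, arXiv:1402.0811, §5.4, the step after Proposition 5.10:
"Making the change of variables `Δ = h₁s₁s₂ − h₂q₁q₂`, and noting that each `Δ` has at most
`τ₃(Δ) = |{(a,b,c) : abc = Δ}|` representations in terms of `h₂, q₁, q₂` for each fixed `h₁, s₁, s₂`,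
we have `∑∑_{q₁,q₂,s₁,s₂ ∼ Q/q₀} ∑∑_{1 ≤ h₁,h₂ ≤ H} (h₁s₁s₂ − h₂q₁q₂, r) ≤ ∑_{|Δ| ≪ H(Q/q₀)²} (Δ,r) ∑∑∑_{h₁,s₁,s₂} τ₃(h₁s₁s₂ − Δ)
⪅ H(Q/q₀)² ∑_{0 ≤ |Δ| ≪ H(Q/q₀)²} (Δ,r) ⪅ H(Q/q₀)² (HQ²/q₀² + R)` by Lemma 1.3 (bounding `τ₃ ≤ τ²`)
and Lemma 1.4."

We PROVE this counting bound in an explicit form, with the divisor bound `τ(m)² ≤ T` on the relevant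
range carried as a hypothesis (the user supplies `T = x^{o(1)}` from the divisor bound, Lemma 1.3):

* `Polymath8a.card_filter_mul_mul_eq_le` — `#{((a, b), c) ∈ S : abc = m} ≤ τ(m)²` for `m ≥ 1` (the
  representations count `τ₃(m) ≤ τ(m)²`);
* `Polymath8a.sum_Icc_neg_gcd_le` — `∑_{|k| ≤ K} (k, r) ≤ 2Kτ(r) + r` (Lemma 1.4, the tree's
  `MatomakiMerikoski2023_lemma37_i`, plus the term `k = 0`);
* `Polymath8a.sum_gcd_shift_le` — `∑_{1 ≤ m ≤ M} (n₀ − m, r) ≤ 2Kτ(r) + r` when `1 ≤ n₀ ≤ K`, `M ≤ K`;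
* `Polymath8a.sum_gcd_bilinear_le` — **(5.33)–(5.34), explicit**: for `1 ≤ Q₁`, `B = [Q₁, Q₂]`,
  `∑_{h₁ ≤ H} ∑_{s₁,s₂ ∈ B} ∑_{h₂ ≤ H} ∑_{q₁,q₂ ∈ B} (h₁s₁s₂ − h₂q₁q₂, r) ≤ (H · #B²) · T · (2(HQ₂²)τ(r) + r)`.

Everything is PROVED (theorems only; no definitions, no named facts).

## References

* D. H. J. Polymath, arXiv:1402.0811: §5.4, the two displays after Proposition 5.10 ((5.33)–(5.34));
  Lemma 1.3, Lemma 1.4. [cite: Polymath8a2014, §5.4 (5.33)–(5.34)]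
-/

open Finset

namespace Literature.NumberTheory.Sieve

namespace Polymath8a

open Literature.NumberTheory.LFunctions.MatomakiMerikoski (MatomakiMerikoski2023_lemma37_i)

/-! ### Representations as a triple product -/

/-- **`τ₃(m) ≤ τ(m)²` in the form needed**: for `m ≥ 1` and any finite set `S` of triples of naturals,
`#{(a,b,c) ∈ S : abc = m} ≤ τ(m)²` (the map `(a,b,c) ↦ (b, bc)` into `divisors m × divisors m` is
injective on the solutions). [cite: Polymath8a2014, §5.4 ("each `Δ` has at most `τ₃(Δ)` representations")] -/
theorem card_filter_mul_mul_eq_le {m : ℕ} (hm : m ≠ 0) (S : Finset ((ℕ × ℕ) × ℕ)) :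
    (S.filter fun t : (ℕ × ℕ) × ℕ => t.1.1 * t.1.2 * t.2 = m).card ≤ m.divisors.card ^ 2 := by
  classical
  rw [sq, ← Finset.card_product]
  refine Finset.card_le_card_of_injOn (fun t : (ℕ × ℕ) × ℕ => (t.1.2, t.1.2 * t.2)) ?_ ?_
  · intro t ht
    rw [Finset.mem_coe, Finset.mem_filter] at ht
    obtain ⟨-, h⟩ := ht
    rw [Finset.mem_coe, Finset.mem_product, Nat.mem_divisors, Nat.mem_divisors]
    exact ⟨⟨⟨t.1.1 * t.2, by rw [← h]; ring⟩, hm⟩, ⟨⟨t.1.1, by rw [← h]; ring⟩, hm⟩⟩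
  · intro t ht t' ht' heq
    rw [Finset.mem_coe, Finset.mem_filter] at ht ht'
    simp only [Prod.mk.injEq] at heq
    obtain ⟨hb, hbc⟩ := heq
    have hb0 : t.1.2 ≠ 0 := by
      intro h0; apply hm; rw [← ht.2, h0]; ring
    have hc : t.2 = t'.2 := by
      rw [hb] at hbc; exact mul_left_cancel₀ (hb ▸ hb0) hbc
    have hbc0 : t.1.2 * t.2 ≠ 0 := by
      intro h0; apply hm; rw [← ht.2, mul_assoc, h0, mul_zero]
    have ha : t.1.1 = t'.1.1 := by
      have h1 : t.1.1 * (t.1.2 * t.2) = t'.1.1 * (t.1.2 * t.2) := by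
        calc t.1.1 * (t.1.2 * t.2) = m := by rw [← ht.2]; ring
          _ = t'.1.1 * (t'.1.2 * t'.2) := by rw [← ht'.2]; ring
          _ = t'.1.1 * (t.1.2 * t.2) := by rw [hb, hc]
      exact mul_right_cancel₀ hbc0 h1
    exact Prod.ext (Prod.ext ha hb) hc

/-- `∑_{s ∪ t} f ≤ ∑_s f + ∑_t f` for nonnegative `f`. [folklore] -/
theorem sum_union_le_add'' {ι : Type*} [DecidableEq ι] (s t : Finset ι) {f : ι → ℝ}
    (hf : ∀ i, 0 ≤ f i) : ∑ i ∈ s ∪ t, f i ≤ ∑ i ∈ s, f i + ∑ i ∈ t, f i := by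
  rw [← Finset.sum_union_inter]
  have : 0 ≤ ∑ i ∈ s ∩ t, f i := Finset.sum_nonneg fun i _ => hf i
  linarith

/-! ### gcd sums over symmetric and shifted ranges (Lemma 1.4) -/

/-- **`∑_{|k| ≤ K} (k, r) ≤ 2Kτ(r) + r`** for `r ≥ 1` (Lemma 1.4 for `1 ≤ k ≤ K` twice, plus `(0, r) = r`).
[cite: Polymath8a2014, Lemma 1.4] -/
theorem sum_Icc_neg_gcd_le {r : ℕ} (hr : r ≠ 0) (K : ℕ) :
    ∑ k ∈ Finset.Icc (-(K : ℤ)) K, (Int.gcd k r : ℝ) ≤ 2 * K * r.divisors.card + r := by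
  -- split into `k = 0`, `k > 0`, `k < 0`
  have hsplit : Finset.Icc (-(K : ℤ)) K =
      ((Finset.Icc 1 K).image (fun n : ℕ => (n : ℤ)) ∪ (Finset.Icc 1 K).image (fun n : ℕ => -(n : ℤ))) ∪ {0} := by
    ext k
    simp only [Finset.mem_Icc, Finset.mem_union, Finset.mem_image, Finset.mem_singleton]
    constructor
    · intro hk
      rcases lt_trichotomy k 0 with h | h | h
      · left; right; exact ⟨k.natAbs, ⟨by omega, by omega⟩, by omega⟩
      · right; exact h
      · left; left; exact ⟨k.natAbs, ⟨by omega, by omega⟩, by omega⟩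
    · rintro ((⟨n, hn, rfl⟩ | ⟨n, hn, rfl⟩) | rfl) <;> omega
  rw [hsplit]
  have hpos : ∑ k ∈ (Finset.Icc 1 K).image (fun n : ℕ => (n : ℤ)), (Int.gcd k r : ℝ) ≤ K * r.divisors.card := by
    rw [Finset.sum_image (fun a _ b _ h => by exact_mod_cast h)]
    have := MatomakiMerikoski2023_lemma37_i hr K
    calc ∑ n ∈ Finset.Icc 1 K, (Int.gcd (n : ℤ) r : ℝ) = ∑ n ∈ Finset.Icc 1 K, (Nat.gcd n r : ℝ) := by
          refine Finset.sum_congr rfl fun n _ => ?_; rw [Int.gcd_natCast_natCast]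
      _ ≤ r.divisors.card * K := this
      _ = K * r.divisors.card := mul_comm _ _
  have hneg : ∑ k ∈ (Finset.Icc 1 K).image (fun n : ℕ => -(n : ℤ)), (Int.gcd k r : ℝ) ≤ K * r.divisors.card := by
    rw [Finset.sum_image (fun a _ b _ h => by exact_mod_cast neg_inj.mp h)]
    have := MatomakiMerikoski2023_lemma37_i hr K
    calc ∑ n ∈ Finset.Icc 1 K, (Int.gcd (-(n : ℤ)) r : ℝ) = ∑ n ∈ Finset.Icc 1 K, (Nat.gcd n r : ℝ) := by
          refine Finset.sum_congr rfl fun n _ => ?_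
          rw [Int.gcd_eq_natAbs, Int.natAbs_neg, Int.natAbs_natCast, Int.natAbs_natCast]
      _ ≤ r.divisors.card * K := this
      _ = K * r.divisors.card := mul_comm _ _
  calc ∑ k ∈ ((Finset.Icc 1 K).image (fun n : ℕ => (n : ℤ)) ∪ (Finset.Icc 1 K).image (fun n : ℕ => -(n : ℤ))) ∪ {0},
        (Int.gcd k r : ℝ)
      ≤ ∑ k ∈ (Finset.Icc 1 K).image (fun n : ℕ => (n : ℤ)) ∪ (Finset.Icc 1 K).image (fun n : ℕ => -(n : ℤ)),
          (Int.gcd k r : ℝ) + ∑ k ∈ ({0} : Finset ℤ), (Int.gcd k r : ℝ) :=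
        sum_union_le_add'' _ _ fun _ => Nat.cast_nonneg _
    _ ≤ (∑ k ∈ (Finset.Icc 1 K).image (fun n : ℕ => (n : ℤ)), (Int.gcd k r : ℝ) +
          ∑ k ∈ (Finset.Icc 1 K).image (fun n : ℕ => -(n : ℤ)), (Int.gcd k r : ℝ)) + r := by
        refine add_le_add (sum_union_le_add'' _ _ fun _ => Nat.cast_nonneg _) (le_of_eq ?_)
        rw [Finset.sum_singleton, Int.gcd_zero_left, Int.natAbs_natCast]
    _ ≤ (K * r.divisors.card + K * r.divisors.card) + r := by linarith
    _ = _ := by ring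

/-- **The shifted gcd sum**: for `1 ≤ n₀ ≤ K` and `M ≤ K`, `∑_{1 ≤ m ≤ M} (n₀ − m, r) ≤ 2Kτ(r) + r`.
[cite: Polymath8a2014, §5.4 and Lemma 1.4] -/
theorem sum_gcd_shift_le {r : ℕ} (hr : r ≠ 0) {K M : ℕ} {n₀ : ℤ} (hn₀ : 1 ≤ n₀) (hn₀K : n₀ ≤ K)
    (hM : M ≤ K) :
    ∑ m ∈ Finset.Icc 1 M, (Int.gcd (n₀ - m) r : ℝ) ≤ 2 * K * r.divisors.card + r := by
  refine le_trans ?_ (sum_Icc_neg_gcd_le hr K)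
  rw [← Finset.sum_image (f := fun k : ℤ => (Int.gcd k r : ℝ)) (s := Finset.Icc 1 M)
    (g := fun m : ℕ => n₀ - m) (fun a _ b _ h => by
      have : (a : ℤ) = b := by simp only at h; linarith
      exact_mod_cast this)]
  refine Finset.sum_le_sum_of_subset_of_nonneg ?_ fun _ _ _ => Nat.cast_nonneg _
  intro k hk
  rw [Finset.mem_image] at hk
  obtain ⟨m, hm, rfl⟩ := hk
  rw [Finset.mem_Icc] at hm ⊢
  constructor <;> omega

/-! ### The bilinear gcd sum -/

/-- **Polymath 8a, (5.33)–(5.34), explicit**: for `1 ≤ Q₁`, `B = [Q₁, Q₂]`, `r ≥ 1`, and a bound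
`τ(m)² ≤ T` valid for `1 ≤ m ≤ HQ₂²`,
`∑_{h₁ ∈ [1,H]} ∑_{s₁,s₂ ∈ B} ∑_{h₂ ∈ [1,H]} ∑_{q₁,q₂ ∈ B} (h₁s₁s₂ − h₂q₁q₂, r) ≤ (H #B²) · T · (2(HQ₂²)τ(r) + r)`
(group the inner triple sum by the value `m = h₂q₁q₂ ∈ [1, HQ₂²]`, which has at most `τ(m)² ≤ T`
representations, and use `sum_gcd_shift_le` with `n₀ = h₁s₁s₂ ∈ [1, HQ₂²]`).  Coprimality conditions on
the variables, as in print, only decrease the left side. [cite: Polymath8a2014, §5.4 (5.33)–(5.34)] -/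
theorem sum_gcd_bilinear_le {r : ℕ} (hr : r ≠ 0) {Q₁ Q₂ H : ℕ} (hQ₁ : 1 ≤ Q₁) {T : ℕ}
    (hT : ∀ m : ℕ, 1 ≤ m → m ≤ H * Q₂ ^ 2 → m.divisors.card ^ 2 ≤ T) :
    ∑ h₁ ∈ Finset.Icc 1 H, ∑ s₁ ∈ Finset.Icc Q₁ Q₂, ∑ s₂ ∈ Finset.Icc Q₁ Q₂,
      ∑ h₂ ∈ Finset.Icc 1 H, ∑ q₁ ∈ Finset.Icc Q₁ Q₂, ∑ q₂ ∈ Finset.Icc Q₁ Q₂,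
        (Int.gcd ((h₁ * s₁ * s₂ : ℕ) - (h₂ * q₁ * q₂ : ℕ)) r : ℝ) ≤
      (H * (Finset.Icc Q₁ Q₂).card ^ 2 : ℕ) * (T * (2 * (H * Q₂ ^ 2 : ℕ) * r.divisors.card + r)) := by
  classical
  set B := Finset.Icc Q₁ Q₂ with hB
  set K : ℕ := H * Q₂ ^ 2 with hK
  -- the range of `h q q'`
  have hrange : ∀ h ∈ Finset.Icc 1 H, ∀ q ∈ B, ∀ q' ∈ B, 1 ≤ h * q * q' ∧ h * q * q' ≤ K := by
    intro h hh q hq q' hq'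
    rw [Finset.mem_Icc] at hh; rw [hB, Finset.mem_Icc] at hq hq'
    constructor
    · have : 1 ≤ q := hQ₁.trans hq.1
      have : 1 ≤ q' := hQ₁.trans hq'.1
      calc 1 = 1 * 1 * 1 := by ring
        _ ≤ h * q * q' := by gcongr; omega
    · calc h * q * q' ≤ H * Q₂ * Q₂ := by gcongr <;> omega
        _ = K := by rw [hK]; ring
  -- the inner triple sum for fixed `n₀ = h₁ s₁ s₂`
  have hinner : ∀ n₀ : ℤ, 1 ≤ n₀ → n₀ ≤ K →
      ∑ h₂ ∈ Finset.Icc 1 H, ∑ q₁ ∈ B, ∑ q₂ ∈ B, (Int.gcd (n₀ - (h₂ * q₁ * q₂ : ℕ)) r : ℝ) ≤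
        T * (2 * K * r.divisors.card + r) := by
    intro n₀ hn₀ hn₀K
    rw [← Finset.sum_product', ← Finset.sum_product']
    -- group by the value `m = h₂ q₁ q₂`
    set S := (Finset.Icc 1 H ×ˢ B) ×ˢ B with hS
    have hmaps : ∀ t ∈ S, (fun t : (ℕ × ℕ) × ℕ => t.1.1 * t.1.2 * t.2) t ∈ Finset.Icc 1 K := by
      intro t ht
      rw [hS, Finset.mem_product, Finset.mem_product] at ht
      rw [Finset.mem_Icc]
      exact hrange t.1.1 ht.1.1 t.1.2 ht.1.2 t.2 ht.2
    rw [show (∑ x ∈ S, (Int.gcd (n₀ - ((x.1.1 * x.1.2 * x.2 : ℕ) : ℤ)) r : ℝ)) =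
        ∑ m ∈ Finset.Icc 1 K, ∑ x ∈ S.filter (fun t => t.1.1 * t.1.2 * t.2 = m),
          (Int.gcd (n₀ - ((x.1.1 * x.1.2 * x.2 : ℕ) : ℤ)) r : ℝ) from
      (Finset.sum_fiberwise_of_maps_to hmaps _).symm]
    calc ∑ m ∈ Finset.Icc 1 K, ∑ x ∈ S.filter (fun t => t.1.1 * t.1.2 * t.2 = m),
          (Int.gcd (n₀ - ((x.1.1 * x.1.2 * x.2 : ℕ) : ℤ)) r : ℝ)
        = ∑ m ∈ Finset.Icc 1 K, (S.filter (fun t => t.1.1 * t.1.2 * t.2 = m)).card * (Int.gcd (n₀ - m) r : ℝ) := by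
          refine Finset.sum_congr rfl fun m _ => ?_
          rw [Finset.sum_congr rfl fun x hx => by rw [(Finset.mem_filter.mp hx).2], Finset.sum_const, nsmul_eq_mul]
      _ ≤ ∑ m ∈ Finset.Icc 1 K, (T : ℝ) * (Int.gcd (n₀ - m) r : ℝ) := by
          refine Finset.sum_le_sum fun m hm => ?_
          rw [Finset.mem_Icc] at hm
          refine mul_le_mul_of_nonneg_right ?_ (Nat.cast_nonneg _)
          have h1 := card_filter_mul_mul_eq_le (m := m) (by omega) S
          have h2 := hT m hm.1 hm.2
          exact_mod_cast h1.trans h2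
      _ = T * ∑ m ∈ Finset.Icc 1 K, (Int.gcd (n₀ - m) r : ℝ) := by rw [Finset.mul_sum]
      _ ≤ T * (2 * K * r.divisors.card + r) :=
          mul_le_mul_of_nonneg_left (sum_gcd_shift_le hr hn₀ hn₀K le_rfl) (Nat.cast_nonneg _)
  -- sum over the outer variables
  calc ∑ h₁ ∈ Finset.Icc 1 H, ∑ s₁ ∈ B, ∑ s₂ ∈ B, ∑ h₂ ∈ Finset.Icc 1 H, ∑ q₁ ∈ B, ∑ q₂ ∈ B,
        (Int.gcd (((h₁ * s₁ * s₂ : ℕ)) - (h₂ * q₁ * q₂ : ℕ)) r : ℝ)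
      ≤ ∑ h₁ ∈ Finset.Icc 1 H, ∑ s₁ ∈ B, ∑ s₂ ∈ B, (T : ℝ) * (2 * K * r.divisors.card + r) := by
        refine Finset.sum_le_sum fun h₁ hh₁ => Finset.sum_le_sum fun s₁ hs₁ => Finset.sum_le_sum fun s₂ hs₂ => ?_
        obtain ⟨h1, h2⟩ := hrange h₁ hh₁ s₁ hs₁ s₂ hs₂
        exact hinner _ (by exact_mod_cast h1) (by exact_mod_cast h2)
    _ = (H * B.card ^ 2 : ℕ) * (T * (2 * K * r.divisors.card + r)) := by
        rw [Finset.sum_const, Finset.sum_const, Finset.sum_const, Nat.card_Icc]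
        simp only [nsmul_eq_mul]
        push_cast
        ring

end Polymath8a

end Literature.NumberTheory.Sieve
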